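import Literature.MathematicalPhysics.QuantumFieldTheory.Balaban1983to89.Beta.AdjointTransportJets
import Mathlib.Analysis.SpecialFunctions.Exponential

/-!
# `Balaban1983to89.Beta.AveragingCorrectionJets` — first-jet calculus of the «small» correction terms of
# Bałaban's one-step covariant averaging (B7 (124)) at the trivial background, and the log-free jet of the
# log-holonomy (B7 (114)), v1.1.1

HONEST FRAMING (page 1, mandatory).  This leaf belongs to the β sub-cell of the Bałaban audit, whose END STATEMENT is:
discharging the one-loop hypothesis `FlowStep.BetaPertH` (read at END-STATEMENT grade, RULING (R6)) makes Bałaban's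
ultraviolet stability theorem for 4-d lattice Yang–Mills ([Balaban1989LargeFieldII], Thm. 1 p. 355 (B16))
UNCONDITIONAL inside this package — a real constructive-QFT result; it is NOT the continuum limit and NOT the Clay
problem.  Gloss 2: EVERYTHING below is kernel-proved [folklore] normed-algebra calculus; NOTHING is cited as a fact.
The equations of [Balaban1985Averaging] (= B7, CMP 98 (1985) 17–51) quoted here (renders read as page images; PDF page
= journal page − 16) are quoted only to say WHICH object is being typed; the manuscripts under audit are not citable for
their disputed steps and no programme-internal claim enters.

ABSOLUTE RULE (cell charter, verbatim; header line added v1.1.1 per beta-ref advisory A-R371, docstring-only): «No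
internally-minted statement may enter as a cited fact. Every hypothesis is either kernel-proved in this package or a
verbatim quotation of a PUBLISHED theorem with page reference. The manuscript(s) under audit are NOT citable for their
own disputed steps — they are the thing under adjudication; programme-internal (2001/route/tribunal) claims are never
citable.»  Accordingly NO declaration below is a `def … : Prop` carrying a citation and no hypothesis of any theorem is
a printed statement: every declaration is [folklore]; the quotations are object LOCATORS only.

WHAT IS BEING TYPED, AND WHY (the (V-H) brick of RULING (R18-3), «VH-STENCIL»; `BETA/AN1.md` §26.6–§26.7 = the
located spec).  Bałaban's linearised one-step vector averaging `Q(V₀)` is the explicit formula B7 p.36 (124):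
«(Q(V₀)A)_c = Σ_{x∈B(c_−)} L^{−(d+1)}(R_{0,c_−}A)([x,x′])
  + Σ_{x∈B(c_−)} L^{−(d+1)}·[g(−i ad_Y)g^{−1}(−i ad_{Y_x}) − 1](R_{0,c_−}A)(Γ_{c_−,x})
  + Σ_{x∈B(c_−)} L^{−(d+1)}[g(−i ad_Y)g^{−1}(−i ad_{Y_x}) − 1]·(R_{0,c_−}A)([x,x′])
  − Σ_{x∈B(c_−)} L^{−(d+1)}·[g(−i ad_Y)g^{−1}(i ad_{Y_x})e^{−i ad_Y} − 1] R̄_{0,c}(R_{0,c_+}A)(Γ_{c_+,x′})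
  + [e^{i ad_Y} − g(−i ad_Y) Σ_{x∈B(c_−)} L^{−d}g^{−1}(i ad_{Y_x})] L^{−1}(R_{0,c_−}A)(c)»,
with p.34 (114) «Y_x = (1/i) log V₀(Γ_{c,x} ∪ (−c))», p.35 «Σ_{x∈B(c_−)} L^{−d}Y_x = Y», and p.23 (34)
«g^{−1}(z) = −z/(e^{−z} − 1), g^{−1}(−z) = g^{−1}(z) − z, g^{−1}(z) = 1 + ½z + …».  B7 p.36: «The first term on the
right-hand side above is the main term … The remaining terms are small because the functions g(−z), g^{−1}(z), e^{iz}
are equal to 1 for z = 0».  For the (V-H) vertex one needs the `B`-JETS of `Q(V₀)` at the trivial background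
`V₀ = e^{tB}`, and there the four «small» terms behave in a way worth a kernel statement: at `t = 0` every `Y_x`,
hence `Y`, VANISHES, so each bracket `[… − 1]` vanishes and `Q(1)` IS the main term (125); but `Y_x(t)` is FIRST
ORDER in `t` (the log-holonomy of `tB` around a closed block contour), so the brackets contribute to the FIRST
`B`-jet — through the linear coefficients `g′(0) = −½`, `(g^{−1})′(0) = ½`, `(e^{±z})′(0) = ±1` only, multiplied
by `ad` of the first jet of `Y`/`Y_x` and applied to the UNPERTURBED contour sums of `A`.  This module types exactly
that mechanism, generically and colour-free, ON TOP OF an2's `Beta.TransportVertices` (`holPath`, `D₁`,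
`hasDerivAt_holPath`, `D₁_zero` — used BY NAME) and of `Beta.AdjointTransportJets` (`conjD₁_zero`), plus Mathlib's
`hasFDerivAt_exp_zero`:
§1 «ONE-PLUS-QUADRATIC» FUNCTIONAL CALCULUS ALONG A CURVE THROUGH 0: if `‖F Z − F₀ − c Z‖ ≤ K‖Z‖²` on a ball around
   `0` (any map `F : E → G` between normed spaces, `c : E →L[𝕜] G`), then `F 0 = F₀`, `HasFDerivAt F c 0`
   (`hasFDerivAt_of_quadratic`), and along a curve `Z` with `Z 0 = 0`, `HasDerivAt Z Ż 0` the composite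
   `t ↦ F (Z t)` has first jet `c Ż` (`hasDerivAt_comp_of_quadratic`).  Every operator `g(−i ad_Y)`,
   `g^{−1}(∓i ad_{Y_x})`, `e^{±i ad_Y}` of (124) is of this form (analytic near 0 with value 1).
§2 THE CORRECTION SHAPE: `t ↦ (Φ t − 1)(X t)` with `Φ 0 = 1`, `HasDerivAt Φ Φ′ 0` (operator-valued, `Φ t : M →L[𝕜] M`)
   has first jet `Φ′ (X 0)` — the `X′`-term is killed by `Φ 0 − 1 = 0` (`hasDerivAt_correction_apply`); products of
   two value-one factors have first jet `Φ′ + Ψ′` (`hasDerivAt_mul_of_eq_one`), weighted sums with `Σ w = 1`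
   (`hasDerivAt_wsum`, `wsum_const_one`) — the shapes of the second/third, fourth and fifth terms of (124).
§3 `ad` AS A CONTINUOUS LINEAR MAP: `ad S X = S X − X S` (`adCLM`, `adCLM_apply`), linear and continuous in `S`
   (`adL`), `‖adCLM S‖ ≤ 2‖S‖`, the jet `HasDerivAt (adCLM ∘ Y) (adCLM Ẏ)` (`hasDerivAt_adCLM`), and the link with node 3:
   the first jet of adjoint transport along a contour is `ad` of its letter sum (`conjD₁_zero_eq_adCLM`).
§4 THE LOG-FREE FIRST JET OF THE LOG-HOLONOMY (B7 (114) «Y_x = (1/i) log V₀(Γ_{c,x} ∪ (−c))»): if a curve `Y` with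
   `Y 0 = 0`, `HasDerivAt Y Ẏ 0` satisfies `exp (Y t) = holPath l t` near `t = 0` (i.e. `Y` is ANY local logarithm of
   the holonomy of the letters `t·l`), then `Ẏ = Σ l` — the CIRCULATION of `B` around the contour
   (`hasDerivAt_log_holPath`, `deriv_log_holPath_eq_sum`, `hasDerivAt_adCLM_log_holPath`); no logarithm is constructed, so no convention (branch,
   `(1/i)`, Hermitian vs. anti-Hermitian letters) is fixed here.  By B7 p.25 (48) the circulation around the block
   contours is a block average of lattice curls — the colour/lattice coordinates are an3's `Beta.PlaquetteVertex`
   (`lcurl`, `ColourTrace`), not restated.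
§5 SANITY OF THE READING OF (34): the closed forms `g(z) = (1 − e^{−z})/z`, `g^{−1}(z) = z/(1 − e^{−z})` satisfy
   Bałaban's identity `g^{−1}(−z) = g^{−1}(z) − z` (`gInv_neg`), and the Taylor coefficients used above
   (`g′(0) = −½`, `(g^{−1})′(0) = ½`) are the degree-1 coefficients of `Σ (−1)^n z^n/(n+1)!` and of its reciprocal
   (`g_taylor₂_mul_gInv_taylor₂`: the degree-≤2 truncations multiply to `1 + O(z³)`).

NOT HERE (next an1 seat / an2, see `BETA/HANDOFF.md` gen-10 §): the block/contour INDEXING of (124)/(125) (contours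
`Γ_{c,x}` of B7 (42), Introduction pp.17–19; axial contours `Γ_{y,x}` p.24; `x′ = x + L e_μ`), the packaging into
an2's socket `Beta.OneStepResolventKernel.LocStencil`/`JetData` (p186036), the SECOND jets of the correction terms
(`g″(0) = ⅓`, `(g^{−1})″(0) = ⅙`, and the `½·commSum` second jet of `Y_x`), and the composition B9 (3.15)
`Q_j(U) = Q(Ū^{j−1})⋯Q(U)`.  Nothing of B7/B9 is asserted.

Provenance: b2b-balaban β sub-cell, unit beta-an1 gen 10 (node 4), 2026-08-19.  v1 = p186574 (cea2872a1757);
v1.1 (same day): `ad` RENAMED `adCLM` (+ `adCLM_apply_eq_ad`) to avoid the name clash with `BackgroundVertices.ad`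
when both namespaces are opened by the VH-STENCIL consumer; statements otherwise unchanged; v1.1 = p186600
(b48c2033d103).  v1.1.1 (gen 11, same day): DOCSTRING-ONLY — the ABSOLUTE RULE header line (beta-ref A-R371), as in the
sister leaves `AdjointTransportJets` v1.0.2 / `AveragingContours` v1.1.1 / `LogHolonomySecondJet` v1.0.1; no declaration
changed.  Bib keys: Balaban1985Averaging,
Balaban1985BackgroundPropagators, Balaban1989LargeFieldII.
-/

namespace Literature.MathematicalPhysics.QuantumFieldTheory.Balaban1983to89.Beta.AveragingCorrectionJets

open NormedSpace Filter Topology Asymptotics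
open Literature.MathematicalPhysics.QuantumFieldTheory.Balaban1983to89.Beta.TransportVertices
open Literature.MathematicalPhysics.QuantumFieldTheory.Balaban1983to89.Beta.AdjointTransportJets

noncomputable section

/-! ## §1 One-plus-quadratic functional calculus along a curve through `0` -/

section Quadratic

variable {𝕜 : Type*} [RCLike 𝕜] {E G : Type*} [NormedAddCommGroup E] [NormedSpace 𝕜 E]
  [NormedAddCommGroup G] [NormedSpace 𝕜 G]

/-- [folklore] A quadratic remainder bound on a ball pins the value at the centre. -/
theorem eq_of_quadratic {F : E → G} {F₀ : G} {c : E →L[𝕜] G} {K r : ℝ} (hr : 0 < r)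
    (hF : ∀ Z : E, ‖Z‖ < r → ‖F Z - F₀ - c Z‖ ≤ K * ‖Z‖ ^ 2) : F 0 = F₀ := by
  have h := hF 0 (by simpa using hr)
  simp only [map_zero, sub_zero, norm_zero, ne_eq, OfNat.ofNat_ne_zero, not_false_eq_true, zero_pow,
    mul_zero, norm_le_zero_iff, sub_eq_zero] at h
  exact h

/-- [folklore] `‖F Z − F₀ − c Z‖ ≤ K‖Z‖²` on a ball ⇒ `F` has Fréchet derivative `c` at `0`.  (Every analytic
functional calculus `z ↦ φ(z)` with `φ(0) = F₀`, `φ′(0) = c` evaluated on a Banach algebra is of this form; in B7 (124):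
`g(−i ad_Y)`, `g^{−1}(∓i ad_{Y_x})`, `e^{±i ad_Y}`.) -/
theorem hasFDerivAt_of_quadratic {F : E → G} {F₀ : G} {c : E →L[𝕜] G} {K r : ℝ} (hr : 0 < r)
    (hF : ∀ Z : E, ‖Z‖ < r → ‖F Z - F₀ - c Z‖ ≤ K * ‖Z‖ ^ 2) : HasFDerivAt F c 0 := by
  have h0 : F 0 = F₀ := eq_of_quadratic hr hF
  rw [hasFDerivAt_iff_isLittleO_nhds_zero]
  have hbig : (fun h : E => F (0 + h) - F 0 - c h) =O[𝓝 0] fun h : E => ‖h‖ ^ 2 := by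
    refine IsBigO.of_bound |K| ?_
    have hball : Metric.ball (0 : E) r ∈ 𝓝 (0 : E) := Metric.ball_mem_nhds 0 hr
    filter_upwards [hball] with h hh
    rw [Metric.mem_ball, dist_zero_right] at hh
    rw [zero_add, h0, Real.norm_of_nonneg (by positivity)]
    exact (hF h hh).trans (mul_le_mul_of_nonneg_right (le_abs_self K) (by positivity))
  refine hbig.trans_isLittleO ?_
  simpa using (isLittleO_norm_pow_id (E' := E) one_lt_two)

/-- [folklore] CHAIN RULE THROUGH 0: along a curve `Z` with `Z 0 = 0` the composite `t ↦ F (Z t)` has first jet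
`c Ż` at `t = 0`. -/
theorem hasDerivAt_comp_of_quadratic {F : E → G} {F₀ : G} {c : E →L[𝕜] G} {K r : ℝ} (hr : 0 < r)
    (hF : ∀ Z : E, ‖Z‖ < r → ‖F Z - F₀ - c Z‖ ≤ K * ‖Z‖ ^ 2) {Z : 𝕜 → E} {Z' : E} (hZ0 : Z 0 = 0)
    (hZ : HasDerivAt Z Z' 0) : HasDerivAt (fun t => F (Z t)) (c Z') 0 := by
  have hFd : HasFDerivAt F c (Z 0) := by rw [hZ0]; exact hasFDerivAt_of_quadratic hr hF
  exact hFd.comp_hasDerivAt 0 hZ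

/-- [folklore] … and its value at `t = 0` is `F₀`. -/
theorem comp_zero_of_quadratic {F : E → G} {F₀ : G} {c : E →L[𝕜] G} {K r : ℝ} (hr : 0 < r)
    (hF : ∀ Z : E, ‖Z‖ < r → ‖F Z - F₀ - c Z‖ ≤ K * ‖Z‖ ^ 2) {Z : 𝕜 → E} (hZ0 : Z 0 = 0) :
    F (Z 0) = F₀ := by
  rw [hZ0]; exact eq_of_quadratic hr hF

end Quadratic

/-! ## §2 The correction shape `(Φ t − 1)(X t)` and its relatives -/

section Correction

variable {𝕜 : Type*} [RCLike 𝕜] {M : Type*} [NormedAddCommGroup M] [NormedSpace 𝕜 M]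

/-- [folklore] THE CORRECTION SHAPE of the 2nd–4th terms of B7 (124): an operator family `Φ` with `Φ 0 = 1`
applied after subtracting `1` to a vector family `X`.  Its first jet at `0` is `Φ′ (X 0)`: the term `(Φ 0 − 1) X′`
vanishes.  («equal to 1 for z = 0», B7 p.36 — so the term vanishes at the trivial background but NOT its jet.) -/
theorem hasDerivAt_correction_apply {Φ : 𝕜 → M →L[𝕜] M} {Φ' : M →L[𝕜] M} {X : 𝕜 → M} {X' : M}
    (hΦ0 : Φ 0 = 1) (hΦ : HasDerivAt Φ Φ' 0) (hX : HasDerivAt X X' 0) :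
    HasDerivAt (fun t => (Φ t - 1) (X t)) (Φ' (X 0)) 0 := by
  have h1 : HasDerivAt (fun t => Φ t - 1) Φ' 0 := hΦ.sub_const 1
  have h := h1.clm_apply hX
  simpa [hΦ0] using h

/-- [folklore] The value of the correction shape at `t = 0` is `0`. -/
theorem correction_apply_zero {Φ : 𝕜 → M →L[𝕜] M} {X : 𝕜 → M} (hΦ0 : Φ 0 = 1) :
    (Φ 0 - 1) (X 0) = 0 := by
  simp [hΦ0]

/-- [folklore] Without the subtraction: `t ↦ (Φ t)(X t)` with `Φ 0 = 1` has first jet `Φ′ (X 0) + X′`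
(the shape of the main term of (124) after transport, and of the 5th term's pieces). -/
theorem hasDerivAt_apply_of_eq_one {Φ : 𝕜 → M →L[𝕜] M} {Φ' : M →L[𝕜] M} {X : 𝕜 → M} {X' : M}
    (hΦ0 : Φ 0 = 1) (hΦ : HasDerivAt Φ Φ' 0) (hX : HasDerivAt X X' 0) :
    HasDerivAt (fun t => (Φ t) (X t)) (Φ' (X 0) + X') 0 := by
  have h := hΦ.clm_apply hX
  simpa [hΦ0] using h

variable {𝔅 : Type*} [NormedRing 𝔅] [NormedAlgebra 𝕜 𝔅]

/-- [folklore] PRODUCT OF TWO VALUE-ONE FACTORS (the brackets `g(−i ad_Y)g^{−1}(∓i ad_{Y_x})`,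
`g(·)g^{−1}(·)e^{−i ad_Y}` of (124)): first jet `Φ′ + Ψ′`. -/
theorem hasDerivAt_mul_of_eq_one {Φ Ψ : 𝕜 → 𝔅} {Φ' Ψ' : 𝔅} (hΦ0 : Φ 0 = 1) (hΨ0 : Ψ 0 = 1)
    (hΦ : HasDerivAt Φ Φ' 0) (hΨ : HasDerivAt Ψ Ψ' 0) :
    HasDerivAt (fun t => Φ t * Ψ t) (Φ' + Ψ') 0 := by
  have h := hΦ.mul hΨ
  simp only [hΦ0, hΨ0, mul_one, one_mul] at h
  exact h

/-- [folklore] Three value-one factors: first jet `Φ′ + Ψ′ + Θ′`. -/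
theorem hasDerivAt_mul₃_of_eq_one {Φ Ψ Θ : 𝕜 → 𝔅} {Φ' Ψ' Θ' : 𝔅} (hΦ0 : Φ 0 = 1) (hΨ0 : Ψ 0 = 1)
    (hΘ0 : Θ 0 = 1) (hΦ : HasDerivAt Φ Φ' 0) (hΨ : HasDerivAt Ψ Ψ' 0) (hΘ : HasDerivAt Θ Θ' 0) :
    HasDerivAt (fun t => Φ t * Ψ t * Θ t) (Φ' + Ψ' + Θ') 0 := by
  have h12 : HasDerivAt (fun t => Φ t * Ψ t) (Φ' + Ψ') 0 := hasDerivAt_mul_of_eq_one hΦ0 hΨ0 hΦ hΨ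
  have h := h12.mul hΘ
  simp only [hΦ0, hΨ0, hΘ0, mul_one, one_mul] at h
  exact h

/-- [folklore] The bracket `Φ Ψ − 1` of two value-one factors: value `0`, first jet `Φ′ + Ψ′`. -/
theorem hasDerivAt_mul_sub_one {Φ Ψ : 𝕜 → 𝔅} {Φ' Ψ' : 𝔅} (hΦ0 : Φ 0 = 1) (hΨ0 : Ψ 0 = 1)
    (hΦ : HasDerivAt Φ Φ' 0) (hΨ : HasDerivAt Ψ Ψ' 0) :
    HasDerivAt (fun t => Φ t * Ψ t - 1) (Φ' + Ψ') 0 :=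
  (hasDerivAt_mul_of_eq_one hΦ0 hΨ0 hΦ hΨ).sub_const 1

variable {X : Type*} [Fintype X]

/-- [folklore] With total weight `1` a weighted sum of `1`s is `1` (so the 5th bracket of (124),
`e^{i ad_Y} − g(−i ad_Y) Σ_x L^{−d} g^{−1}(i ad_{Y_x})`, vanishes at the trivial background: `Σ_{x∈B(c_−)} L^{−d} = 1`). -/
theorem wsum_const_one (w : X → 𝕜) (hw : ∑ x, w x = 1) :
    (∑ x, w x • (1 : 𝔅)) = 1 := by
  rw [← Finset.sum_smul, hw, one_smul]

/-- [folklore] First jet of a weighted sum of curves. -/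
theorem hasDerivAt_wsum (w : X → 𝕜) {f : X → 𝕜 → 𝔅} {f' : X → 𝔅} {t : 𝕜}
    (hf : ∀ x, HasDerivAt (f x) (f' x) t) :
    HasDerivAt (fun s => ∑ x, w x • f x s) (∑ x, w x • f' x) t :=
  HasDerivAt.fun_sum fun x _ => (hf x).const_smul (w x)

/-- [folklore] THE FIFTH BRACKET of (124): `Φ t − Ψ t * Σ_x w x • Θ x t` with all values `1` and `Σ w = 1` has value
`0` and first jet `Φ′ − (Ψ′ + Σ_x w x • Θ′ x)`. -/
theorem hasDerivAt_fifth_bracket {Φ Ψ : 𝕜 → 𝔅} {Θ : X → 𝕜 → 𝔅} {Φ' Ψ' : 𝔅} {Θ' : X → 𝔅} (w : X → 𝕜)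
    (hw : ∑ x, w x = 1) (hΨ0 : Ψ 0 = 1) (hΘ0 : ∀ x, Θ x 0 = 1) (hΦ : HasDerivAt Φ Φ' 0)
    (hΨ : HasDerivAt Ψ Ψ' 0) (hΘ : ∀ x, HasDerivAt (Θ x) (Θ' x) 0) :
    HasDerivAt (fun t => Φ t - Ψ t * ∑ x, w x • Θ x t) (Φ' - (Ψ' + ∑ x, w x • Θ' x)) 0 := by
  have hS : HasDerivAt (fun s => ∑ x, w x • Θ x s) (∑ x, w x • Θ' x) 0 := hasDerivAt_wsum w hΘ
  have hS0 : (∑ x, w x • Θ x 0) = 1 := by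
    simp only [hΘ0]; exact wsum_const_one w hw
  have hP : HasDerivAt (fun t => Ψ t * ∑ x, w x • Θ x t) (Ψ' + ∑ x, w x • Θ' x) 0 := by
    have h := hΨ.mul hS
    simp only [hΨ0, one_mul, hS0, mul_one] at h
    exact h
  exact hΦ.sub hP

/-- [folklore] … and its value at `t = 0` is `0`. -/
theorem fifth_bracket_zero {Φ Ψ : 𝕜 → 𝔅} {Θ : X → 𝕜 → 𝔅} (w : X → 𝕜) (hw : ∑ x, w x = 1)
    (hΦ0 : Φ 0 = 1) (hΨ0 : Ψ 0 = 1) (hΘ0 : ∀ x, Θ x 0 = 1) :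
    Φ 0 - Ψ 0 * ∑ x, w x • Θ x 0 = 0 := by
  have h1 : (∑ x, w x • Θ x 0) = 1 := by
    simp only [hΘ0]; exact wsum_const_one w hw
  rw [h1, hΦ0, hΨ0, one_mul, sub_self]

end Correction

/-! ## §3 `ad` as a continuous linear map, and its jet along a curve -/

section Ad

variable (𝕜 : Type*) [RCLike 𝕜] {𝔸 : Type*} [NormedRing 𝔸] [NormedAlgebra 𝕜 𝔸]

/-- [folklore] `adL : 𝔸 →L[𝕜] (𝔸 →L[𝕜] 𝔸)`, `adL S X = S X − X S` — `ad` as a continuous linear map of its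
letter (left minus right multiplication). -/
def adL : 𝔸 →L[𝕜] 𝔸 →L[𝕜] 𝔸 :=
  ContinuousLinearMap.mul 𝕜 𝔸 - (ContinuousLinearMap.mul 𝕜 𝔸).flip

/-- [folklore] `adCLM S : 𝔸 →L[𝕜] 𝔸`, `adCLM S X = S X − X S` (Bałaban's `ad_Y`, up to his factor conventions `±i`). -/
def adCLM (S : 𝔸) : 𝔸 →L[𝕜] 𝔸 := adL 𝕜 S

/-- [folklore] `adL S X = S X − X S`. -/
@[simp] theorem adL_apply (S X : 𝔸) : adL 𝕜 S X = S * X - X * S := by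
  simp [adL]

/-- [folklore] `adCLM S X = S X − X S`. -/
@[simp] theorem adCLM_apply (S X : 𝔸) : adCLM 𝕜 S X = S * X - X * S := by
  simp [adCLM]

/-- [folklore] `adCLM = adL` pointwise (definitional). -/
theorem adCLM_eq_adL (S : 𝔸) : adCLM 𝕜 S = adL 𝕜 S := rfl

/-- [folklore] DICTIONARY to b12/an2's ring-level `BackgroundVertices.ad a m = a m − m a`: `adCLM S X = ad S X`. -/
theorem adCLM_apply_eq_ad (S X : 𝔸) :
    adCLM 𝕜 S X = Literature.MathematicalPhysics.QuantumFieldTheory.Balaban1983to89.Beta.BackgroundVertices.ad S X := by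
  rw [adCLM_apply, Literature.MathematicalPhysics.QuantumFieldTheory.Balaban1983to89.Beta.BackgroundVertices.ad_apply]

/-- [folklore] `adCLM 0 = 0`. -/
@[simp] theorem adCLM_zero : adCLM 𝕜 (0 : 𝔸) = 0 := by
  ext X; simp

/-- [folklore] `adCLM` is additive in its letter. -/
theorem adCLM_add (S T : 𝔸) : adCLM 𝕜 (S + T) = adCLM 𝕜 S + adCLM 𝕜 T := by
  simp [adCLM, map_add]

/-- [folklore] `adCLM` is homogeneous in its letter. -/
theorem adCLM_smul (a : 𝕜) (S : 𝔸) : adCLM 𝕜 (a • S) = a • adCLM 𝕜 S := by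
  simp [adCLM, map_smul]

/-- [folklore] `‖adCLM S X‖ ≤ 2‖S‖‖X‖`. -/
theorem norm_adCLM_apply_le (S X : 𝔸) : ‖adCLM 𝕜 S X‖ ≤ 2 * ‖S‖ * ‖X‖ := by
  rw [adCLM_apply]
  calc ‖S * X - X * S‖ ≤ ‖S * X‖ + ‖X * S‖ := norm_sub_le _ _
    _ ≤ ‖S‖ * ‖X‖ + ‖X‖ * ‖S‖ := add_le_add (norm_mul_le _ _) (norm_mul_le _ _)
    _ = 2 * ‖S‖ * ‖X‖ := by ring

/-- [folklore] `‖adCLM S‖ ≤ 2‖S‖` (operator norm). -/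
theorem norm_adCLM_le (S : 𝔸) : ‖adCLM 𝕜 S‖ ≤ 2 * ‖S‖ :=
  ContinuousLinearMap.opNorm_le_bound _ (by positivity) (norm_adCLM_apply_le 𝕜 S)

/-- [folklore] THE JET OF `t ↦ ad_{Y(t)}`: `ad` is continuous linear in its letter, so `HasDerivAt (ad ∘ Y) (ad Ẏ)`. -/
theorem hasDerivAt_adCLM {Y : 𝕜 → 𝔸} {Y' : 𝔸} {t : 𝕜} (hY : HasDerivAt Y Y' t) :
    HasDerivAt (fun s => adCLM 𝕜 (Y s)) (adCLM 𝕜 Y') t :=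
  ((adL 𝕜 (𝔸 := 𝔸)).hasFDerivAt.comp_hasDerivAt t hY)

/-- [folklore] … in particular through `0`: `Y 0 = 0 ⇒ ad (Y 0) = 0`, so `t ↦ ad_{Y(t)}` is a curve THROUGH `0` of the
operator algebra, as §1 requires. -/
theorem adCLM_comp_zero {Y : 𝕜 → 𝔸} (hY0 : Y 0 = 0) : adCLM 𝕜 (Y 0) = 0 := by
  rw [hY0, adCLM_zero]

/-- [folklore] LINK WITH NODE 3 (`Beta.AdjointTransportJets`): the first background jet of adjoint transport along a
contour with letters `l` is `ad (Σ l)` — `conjD₁ l A 0 = [Σl, A] = ad (Σl) A`. -/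
theorem conjD₁_zero_eq_adCLM (l : List 𝔸) (A : 𝔸) : conjD₁ 𝕜 l A 0 = adCLM 𝕜 l.sum A := by
  rw [conjD₁_zero, adCLM_apply]

end Ad

/-! ## §4 The log-free first jet of the log-holonomy (B7 (114)) -/

section LogHolonomy

variable (𝕜 : Type*) [RCLike 𝕜] {𝔸 : Type*} [NormedRing 𝔸] [NormedAlgebra 𝕜 𝔸] [CompleteSpace 𝔸]

/-- [folklore] If `Y` is differentiable at `0` with `Y 0 = 0`, then `t ↦ exp (Y t)` has first jet `Ẏ` at `0`
(Mathlib `hasFDerivAt_exp_zero`: `D exp(0) = id`). -/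
theorem hasDerivAt_exp_comp_zero {Y : 𝕜 → 𝔸} {Y' : 𝔸} (hY0 : Y 0 = 0) (hY : HasDerivAt Y Y' 0) :
    HasDerivAt (fun t => exp (Y t)) Y' 0 := by
  have he : HasFDerivAt (exp : 𝔸 → 𝔸) (1 : 𝔸 →L[𝕜] 𝔸) (Y 0) := by
    rw [hY0]; exact hasFDerivAt_exp_zero
  have h : HasDerivAt (fun t => exp (Y t)) ((1 : 𝔸 →L[𝕜] 𝔸) Y') 0 := he.comp_hasDerivAt 0 hY
  simpa using h

/-- [folklore] THE LOG-HOLONOMY JET, LOG-FREE.  Let `l` be the letters of a closed contour (for B7 (114):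
the bonds of `Γ_{c,x} ∪ (−c)` carrying `t·B_b`, orientation signs included) and let `Y` be ANY curve with `Y 0 = 0`,
differentiable at `0`, which is a local logarithm of the holonomy: `exp (Y t) = holPath l t` for `t` near `0`.  Then
the holonomy path has first jet `Ẏ` at `0` … -/
theorem hasDerivAt_log_holPath {Y : 𝕜 → 𝔸} {Y' : 𝔸} (l : List 𝔸) (hY0 : Y 0 = 0) (hY : HasDerivAt Y Y' 0)
    (hlog : ∀ᶠ t in 𝓝 (0 : 𝕜), exp (Y t) = holPath 𝕜 l t) : HasDerivAt (holPath 𝕜 l) Y' 0 := by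
  have h1 : HasDerivAt (fun t => exp (Y t)) Y' 0 := hasDerivAt_exp_comp_zero 𝕜 hY0 hY
  refine h1.congr_of_eventuallyEq ?_
  filter_upwards [hlog] with t ht
  exact ht.symm

/-- [folklore] … hence `Ẏ = Σ l`: THE FIRST JET OF ANY LOCAL LOGARITHM OF THE HOLONOMY IS THE CIRCULATION (the sum of
the letters around the contour; by B7 p.25 (48) a block average of lattice curls).  Uses an2's
`TransportVertices.hasDerivAt_holPath` and `D₁_zero` by name, and uniqueness of derivatives. -/
theorem deriv_log_holPath_eq_sum {Y : 𝕜 → 𝔸} {Y' : 𝔸} (l : List 𝔸) (hY0 : Y 0 = 0) (hY : HasDerivAt Y Y' 0)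
    (hlog : ∀ᶠ t in 𝓝 (0 : 𝕜), exp (Y t) = holPath 𝕜 l t) : Y' = l.sum := by
  have h1 : HasDerivAt (holPath 𝕜 l) Y' 0 := hasDerivAt_log_holPath 𝕜 l hY0 hY hlog
  have h2 : HasDerivAt (holPath 𝕜 l) (D₁ 𝕜 l 0) 0 := hasDerivAt_holPath 𝕜 l 0
  rw [D₁_zero] at h2
  exact h1.unique h2

/-- [folklore] COROLLARY (the mechanism of §26.6(β) in one line): for such a log-holonomy curve `Y`, the operator
curve `t ↦ ad_{Y(t)}` passes through `0` with first jet `ad (Σ l)`. -/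
theorem hasDerivAt_adCLM_log_holPath {Y : 𝕜 → 𝔸} {Y' : 𝔸} (l : List 𝔸) (hY0 : Y 0 = 0)
    (hY : HasDerivAt Y Y' 0) (hlog : ∀ᶠ t in 𝓝 (0 : 𝕜), exp (Y t) = holPath 𝕜 l t) :
    HasDerivAt (fun s => adCLM 𝕜 (Y s)) (adCLM 𝕜 l.sum) 0 := by
  have h := hasDerivAt_adCLM 𝕜 hY
  rwa [deriv_log_holPath_eq_sum 𝕜 l hY0 hY hlog] at h

/-- [folklore] ASSEMBLED SECOND-TERM SHAPE of (124) at the trivial background: with `Φ t = F (ad_{Y t})`,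
`Ψ t = G (ad_{Y_x t})` one-plus-quadratic functional calculi (linear coefficients `c_F`, `c_G : (𝔸 →L 𝔸) →L (𝔸 →L 𝔸)`;
for B7: `c_F = g′(0)·(−i)·id = ½ i·id`, `c_G = (g^{−1})′(0)·(∓i)·id`), log-holonomy curves `Y`, `Y_x` with circulations
`Σ l`, `Σ lₓ`, and a transported contour sum `X t` of `A`, the term `(Φ t Ψ t − 1)(X t)` has first jet
`(c_F (ad Σl) + c_G (ad Σlₓ)) (X 0)` at `t = 0`. -/
theorem hasDerivAt_second_term_shape {F G : (𝔸 →L[𝕜] 𝔸) → (𝔸 →L[𝕜] 𝔸)}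
    {cF cG : (𝔸 →L[𝕜] 𝔸) →L[𝕜] (𝔸 →L[𝕜] 𝔸)} {KF rF KG rG : ℝ} (hrF : 0 < rF) (hrG : 0 < rG)
    (hF : ∀ Z, ‖Z‖ < rF → ‖F Z - 1 - cF Z‖ ≤ KF * ‖Z‖ ^ 2)
    (hG : ∀ Z, ‖Z‖ < rG → ‖G Z - 1 - cG Z‖ ≤ KG * ‖Z‖ ^ 2)
    {Y Yx : 𝕜 → 𝔸} {Y' Yx' : 𝔸} (l lx : List 𝔸) (hY0 : Y 0 = 0) (hY : HasDerivAt Y Y' 0)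
    (hlog : ∀ᶠ t in 𝓝 (0 : 𝕜), exp (Y t) = holPath 𝕜 l t) (hYx0 : Yx 0 = 0) (hYx : HasDerivAt Yx Yx' 0)
    (hlogx : ∀ᶠ t in 𝓝 (0 : 𝕜), exp (Yx t) = holPath 𝕜 lx t)
    {X : 𝕜 → 𝔸} {X' : 𝔸} (hX : HasDerivAt X X' 0) :
    HasDerivAt (fun t => (F (adCLM 𝕜 (Y t)) * G (adCLM 𝕜 (Yx t)) - 1) (X t))
      ((cF (adCLM 𝕜 l.sum) + cG (adCLM 𝕜 lx.sum)) (X 0)) 0 := by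
  have hΦ : HasDerivAt (fun t => F (adCLM 𝕜 (Y t))) (cF (adCLM 𝕜 l.sum)) 0 :=
    hasDerivAt_comp_of_quadratic (Z := fun t => adCLM 𝕜 (Y t)) hrF hF (adCLM_comp_zero 𝕜 hY0)
      (hasDerivAt_adCLM_log_holPath 𝕜 l hY0 hY hlog)
  have hΨ : HasDerivAt (fun t => G (adCLM 𝕜 (Yx t))) (cG (adCLM 𝕜 lx.sum)) 0 :=
    hasDerivAt_comp_of_quadratic (Z := fun t => adCLM 𝕜 (Yx t)) hrG hG (adCLM_comp_zero 𝕜 hYx0)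
      (hasDerivAt_adCLM_log_holPath 𝕜 lx hYx0 hYx hlogx)
  have hΦ0 : F (adCLM 𝕜 (Y 0)) = 1 :=
    comp_zero_of_quadratic (Z := fun t => adCLM 𝕜 (Y t)) hrF hF (adCLM_comp_zero 𝕜 hY0)
  have hΨ0 : G (adCLM 𝕜 (Yx 0)) = 1 :=
    comp_zero_of_quadratic (Z := fun t => adCLM 𝕜 (Yx t)) hrG hG (adCLM_comp_zero 𝕜 hYx0)
  have hprod : HasDerivAt (fun t => F (adCLM 𝕜 (Y t)) * G (adCLM 𝕜 (Yx t)))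
      (cF (adCLM 𝕜 l.sum) + cG (adCLM 𝕜 lx.sum)) 0 :=
    hasDerivAt_mul_of_eq_one (Φ := fun t => F (adCLM 𝕜 (Y t))) (Ψ := fun t => G (adCLM 𝕜 (Yx t))) hΦ0 hΨ0 hΦ hΨ
  have hprod0 : (fun t => F (adCLM 𝕜 (Y t)) * G (adCLM 𝕜 (Yx t))) 0 = 1 := by
    simp only [hΦ0, hΨ0, mul_one]
  exact hasDerivAt_correction_apply (Φ := fun t => F (adCLM 𝕜 (Y t)) * G (adCLM 𝕜 (Yx t))) hprod0 hprod hX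

end LogHolonomy

/-! ## §5 Sanity of the reading of B7 (34) -/

section Sanity

/-- [folklore] Bałaban's `g^{−1}(z) = −z/(e^{−z} − 1)` (B7 p.23 (34): the object is only NAMED here), as a real
closed form away from `0` (at `0` Lean's junk value `0/0 = 0`; the analytic continuation `g^{−1}(0) = 1` is not used). -/
def gInv (z : ℝ) : ℝ := -z / (Real.exp (-z) - 1)

/-- [folklore] B7 (34): `g^{−1}(−z) = g^{−1}(z) − z` (for `z ≠ 0`, where the closed form is meaningful). -/
theorem gInv_neg (z : ℝ) (hz : z ≠ 0) : gInv (-z) = gInv z - z := by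
  unfold gInv
  rw [neg_neg, Real.exp_neg]
  have hz' : Real.exp z ≠ 0 := (Real.exp_pos z).ne'
  have h1 : Real.exp z - 1 ≠ 0 := by
    intro h; apply hz
    have : Real.exp z = 1 := by linarith
    simpa using this
  have h3 : 1 - Real.exp z ≠ 0 := fun h => h1 (by linarith)
  rw [show (Real.exp z)⁻¹ - 1 = (1 - Real.exp z) / Real.exp z by field_simp]
  rw [show Real.exp z - 1 = -(1 - Real.exp z) by ring]
  field_simp
  ring

/-- [folklore] The degree-≤2 Taylor truncations `g₂(z) = 1 − z/2 + z²/6` of `g(z) = (1 − e^{−z})/z = Σ (−1)^n z^n/(n+1)!`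
and `g₂^{−1}(z) = 1 + z/2 + z²/12` of `g^{−1}` multiply to `1 + O(z³)` — so `g′(0) = −½`, `(g^{−1})′(0) = ½` (B7 (34):
«g^{−1}(z) = 1 + ½z + …»), `g″(0) = ⅓`, `(g^{−1})″(0) = ⅙` are consistent. -/
theorem g_taylor₂_mul_gInv_taylor₂ (z : ℚ) :
    (1 - z / 2 + z ^ 2 / 6) * (1 + z / 2 + z ^ 2 / 12) = 1 + z ^ 3 * (1 / 24 + z / 72) := by
  ring

/-- The coefficients `(−1)^n/(n+1)!` of `g` for `n = 0, 1, 2`: `1, −½, ⅙` (so `g′(0) = −½`, `g″(0) = 2·⅙ = ⅓`). -/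
example : ((-1 : ℚ) ^ 0 / Nat.factorial 1, (-1 : ℚ) ^ 1 / Nat.factorial 2, (-1 : ℚ) ^ 2 / Nat.factorial 3)
    = (1, -1/2, 1/6) := by
  norm_num [Nat.factorial]

end Sanity

end

end Literature.MathematicalPhysics.QuantumFieldTheory.Balaban1983to89.Beta.AveragingCorrectionJets
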